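import Summits.FinalStateConjecture.FinalStateConjecture.Theorems.PhotonSphereChannelsChannelsResolveTameDevelopmentsRSilentHull
import HarnessLib

/-!
# Route PhotonSphereChannels · crux `ChannelsResolveTameDevelopmentsR` (K2R-T2, stmt-FinalStateConjecture-17430) ·
# line `tame-lasalle-dock` · stub A″ `stub_silentHullCore` (Reshape 1b of lead c8): the producer WITHOUT the shadowing clause

The composition of the line (`Cruxes/ChannelsResolveTameDevelopmentsR/Lines/tame_lasalle_dock.lean`, §4) consumes from the
producer stub only the nonempty outer region, `OuterHullExists` and `GeneratorHullExists`; clause (c) `OuterHullShadowed` of the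
inherited stub A′ `stub_silentHull` (line `dark-future-exactness`, where shadowing fed the generator constancy into the
classification of outer elements) is NOT used, because SEK classifies outer elements directly. Reshape 1b therefore replaces A′
by the strictly weaker A″ `stub_silentHullCore` (A′ minus (c)), which removes the producer (F5) `HorizonThreading` (horizon
lineage + threading of re-based sequences) from the crux's residue altogether. This file proves A″'s registered text from the
remaining typed producers of `…RSilentHull.lean` (stub-worker A, p159801): (F1) `HasCompleteRay`, (F0) `AllOrdersTameOuter`,
(F4a) `EventuallyTameAlongHorizon`, (F2) `TameEndOfOuterLimit`, (F4b) `TameEndOfHorizonLimit`, (F3) `SilentUpgrade` — by the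
landed clause lemmas `outerHullExists_of_upgrade`, `generatorHullExists_of_upgrade`, `hasCompleteRay_iff_outerRegion_nonempty`.
A″'s text appears only as a conclusion.

References: Anderson 2004, Def. 1.1 and Thm. 5.1 [Anderson2004]; Chruściel–Delay–Galloway–Howard 2001, Thm. 1.1
[ChruscielEtAl2001]; Hawking–Ellis 1973, §9.2 [HawkingEllis1973CUP].
-/

noncomputable section

-- the operator-norm instance on `E4 →L[ℝ] E4 →L[ℝ] ℝ` needs one more level of pending
-- instance problems than the default (as in `PhotonSphereChannelsTameHullDefs.lean`)
set_option maxSynthPendingDepth 3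
-- every `Summit.FinalStateConjecture.FinalStateConjecture.…` name repeats the summit = sub-problem segment (D-0017 layout)
set_option linter.dupNamespace false

open Set Filter Function TopologicalSpace Manifold Bundle
open scoped Topology Manifold ContDiff ENNReal NNReal

namespace Summit.FinalStateConjecture.FinalStateConjecture.Theorems.TameLaSalle

open Literature.Geometry.Lorentzian
open Summit.FinalStateConjecture.FinalStateConjecture.Theorems.TameHull
open Summit.FinalStateConjecture.FinalStateConjecture.Theorems.DarkFuture

section One

variable {X : Type} [TopologicalSpace X] [ChartedSpace E3 X] [IsManifold (𝓡 3) ∞ X]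
  [T2Space X] [SecondCountableTopology X] [ConnectedSpace X] {D : InitialDataSet (𝓡 3) X}
  (𝒟 : VacuumCauchyDevelopment D) [𝒟.metric.HasLeviCivita]

omit [T2Space X] [SecondCountableTopology X] in
/-- **A″ for ONE development from the inputs (no shadowing, no threading).** [cite: Anderson2004, Def. 1.1 and Thm 5.1] -/
theorem silentHullCore_of_producers_one (hray : HasCompleteRay 𝒟) {Λ₀ : ℕ → ℝ≥0} {r₁ : ℝ} (hr₁ : 0 < r₁)
    (h0 : AllOrdersTameOuter 𝒟 Λ₀ r₁) {Λ₁ : ℕ → ℝ≥0} {r₂ : ℝ} (hr₂ : 0 < r₂) (h4a : EventuallyTameAlongHorizon 𝒟 Λ₁ r₂)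
    {Λ : ℕ → ℝ≥0} {r₀ : ℝ} (hr₀ : 0 < r₀) (h2 : TameEndOfOuterLimit 𝒟 Λ r₀) (h4b : TameEndOfHorizonLimit 𝒟 Λ r₀)
    (h3 : SilentUpgrade 𝒟 Λ r₀) :
    (outerRegion 𝒟).Nonempty ∧
      ∃ (Λ : ℕ → ℝ≥0) (r₀ : ℝ), 0 < r₀ ∧ OuterHullExists 𝒟 Λ r₀ ∧ GeneratorHullExists 𝒟 Λ r₀ :=
  ⟨(hasCompleteRay_iff_outerRegion_nonempty 𝒟).1 hray, Λ, r₀, hr₀, outerHullExists_of_upgrade hr₁ h0 h2 h3,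
    generatorHullExists_of_upgrade hr₂ h4a h4b h3⟩

end One

/-- **Reduction of stub A″ `stub_silentHullCore` to its typed sub-producers** (A″'s registered text VERBATIM as the conclusion;
registered sub-goal `silentHullCore_of_producers` of stmt-FinalStateConjecture-17430). If every MGHD `𝒟` of admissible data with
`DevHyp 𝒟` has (F1) a complete normalised null ray from `Σ`, (F0) an all-orders tame outer region and (F4a) all-orders tame balls
eventually along every horizon generator path, and, in ONE class `(Λ, r₀)`, `0 < r₀`, (F2) ends on its outer vacuum limits, (F4b)
ends with lineage on its horizon vacuum limits and (F3) the silent upgrade, then the nonempty outer region, `OuterHullExists` and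
`GeneratorHullExists` hold in that class. (F5) `HorizonThreading` is not needed. [cite: Anderson2004, Def. 1.1 and Thm 5.1] -/
theorem silentHullCore_of_producers : (∀ {X : Type} [TopologicalSpace X] [ChartedSpace E3 X] [IsManifold (𝓡 3) ∞ X] [T2Space X] [SecondCountableTopology X] [ConnectedSpace X] {D : InitialDataSet (𝓡 3) X}, D ∈ admissibleVacuumData X → ∀ (𝒟 : VacuumCauchyDevelopment D) [𝒟.metric.HasLeviCivita], DevHyp 𝒟 → HasCompleteRay 𝒟) → (∀ {X : Type} [TopologicalSpace X] [ChartedSpace E3 X] [IsManifold (𝓡 3) ∞ X] [T2Space X] [SecondCountableTopology X] [ConnectedSpace X] {D : InitialDataSet (𝓡 3) X}, D ∈ admissibleVacuumData X → ∀ (𝒟 : VacuumCauchyDevelopment D) [𝒟.metric.HasLeviCivita], DevHyp 𝒟 → (∃ (Λ₀ : ℕ → ℝ≥0) (r₁ : ℝ), 0 < r₁ ∧ AllOrdersTameOuter 𝒟 Λ₀ r₁) ∧ ∃ (Λ₁ : ℕ → ℝ≥0) (r₂ : ℝ), 0 < r₂ ∧ EventuallyTameAlongHorizon 𝒟 Λ₁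 r₂) → (∀ {X : Type} [TopologicalSpace X] [ChartedSpace E3 X] [IsManifold (𝓡 3) ∞ X] [T2Space X] [SecondCountableTopology X] [ConnectedSpace X] {D : InitialDataSet (𝓡 3) X}, D ∈ admissibleVacuumData X → ∀ (𝒟 : VacuumCauchyDevelopment D) [𝒟.metric.HasLeviCivita], DevHyp 𝒟 → ∃ (Λ : ℕ → ℝ≥0) (r₀ : ℝ), 0 < r₀ ∧ TameEndOfOuterLimit 𝒟 Λ r₀ ∧ TameEndOfHorizonLimit 𝒟 Λ r₀ ∧ SilentUpgrade 𝒟 Λ r₀) → ∀ (X : Type) [TopologicalSpace X] [ChartedSpace E3 X] [IsManifold (𝓡 3) ∞ X] [T2Space X] [SecondCountableTopology X] [ConnectedSpace X], ∀ D ∈ admissibleVacuumData X, ∀ (𝒟 : VacuumCauchyDevelopment D) [𝒟.metric.HasLeviCivita], DevHyp 𝒟 → (outerRegion 𝒟).Nonempty ∧ ∃ (Λ : ℕ → ℝ≥0) (r₀ : ℝ), 0 < r₀ ∧ OuterHullExists 𝒟 Λ r₀ ∧ GeneratorHullExists 𝒟 Λ r₀ := by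
  intro hF1 hF0 hF X _ _ _ _ _ _ D hD 𝒟 _ hdev
  obtain ⟨⟨Λ₀, r₁, hr₁, h0⟩, Λ₁, r₂, hr₂, h4a⟩ := hF0 hD 𝒟 hdev
  obtain ⟨Λ, r₀, hr₀, h2, h4b, h3⟩ := hF hD 𝒟 hdev
  exact silentHullCore_of_producers_one 𝒟 (hF1 hD 𝒟 hdev) hr₁ h0 hr₂ h4a hr₀ h2 h4b h3

/-- **A′ implies A″** (the reshape only weakens the producer stub). [folklore] -/
theorem silentHullCore_of_silentHull (hA : ∀ (X : Type) [TopologicalSpace X] [ChartedSpace E3 X] [IsManifold (𝓡 3) ∞ X] [T2Space X] [SecondCountableTopology X] [ConnectedSpace X], ∀ D ∈ admissibleVacuumData X, ∀ (𝒟 : VacuumCauchyDevelopment D) [𝒟.metric.HasLeviCivita], DevHyp 𝒟 → (outerRegion 𝒟).Nonempty ∧ ∃ (Λ : ℕ → ℝ≥0) (r₀ : ℝ), 0 < r₀ ∧ OuterHullExists 𝒟 Λ r₀ ∧ GeneratorHullExists 𝒟 Λ r₀ ∧ OuterHullShadowed 𝒟 Λ r₀) : ∀ (X : Type) [TopologicalSpace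 X] [ChartedSpace E3 X] [IsManifold (𝓡 3) ∞ X] [T2Space X] [SecondCountableTopology X] [ConnectedSpace X], ∀ D ∈ admissibleVacuumData X, ∀ (𝒟 : VacuumCauchyDevelopment D) [𝒟.metric.HasLeviCivita], DevHyp 𝒟 → (outerRegion 𝒟).Nonempty ∧ ∃ (Λ : ℕ → ℝ≥0) (r₀ : ℝ), 0 < r₀ ∧ OuterHullExists 𝒟 Λ r₀ ∧ GeneratorHullExists 𝒟 Λ r₀ := by
  intro X _ _ _ _ _ _ D hD 𝒟 _ hdev
  obtain ⟨hne, Λ, r₀, hr₀, ha, hb, -⟩ := hA X D hD 𝒟 hdev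
  exact ⟨hne, Λ, r₀, hr₀, ha, hb⟩

end Summit.FinalStateConjecture.FinalStateConjecture.Theorems.TameLaSalle

end
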